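import Summits.RiemannHypothesis.RiemannHypothesis.Theorems.PfPersistenceF5CombPSD
import HarnessLib

/-!
# PF persistence, fake seat 5 — THEOREM F5-COMB: signed re-weightings are caught at ℓ¹ depth

Unit `pub-rhpf-fake-5` (gen 5) of the `pub-rhpf` cell — mechanism / rigidity campaign; **no RH claims**.
(FAKES.md §5.8 ADDENDUM 2; GAP-CLASSES row F5-SWAP-G.)

Family (FAKES §5.8): a table `w'` equal to `ζ`'s von Mangoldt table `w_ζ` off a finite set `S` of
sites, `c_n := w'(n) − w_ζ(n)`, `n ∈ S`.  THEOREM F5-PAIR (`PfPersistenceF5SignedTwins`) catches a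
pair swap with a single twin at depth `max|cᵢ|·D`, `D` the pair margin; the window DATA (kit jobs
j075458 / j075669) show the bottom eigenvector harvesting the full `ℓ¹` mass `Σ|c_n|` instead.  This file
proves the mechanism behind the data: a signed COMB `g = Σ_j ε_j g₁(· − x_j)` of translates of one
real test `g₁ ⊆ [-b, b]`.

* `autocorrRe_combRe` — the lag profile of a comb is the signed sum of shifted profiles,
  `A_g(y) = Σ_{j,l} ε_j ε_l A_{g₁}(y − (x_j − x_l))`;
* `comb_re_eq` — EXACT IDENTITY `Re Q_{w'}(g) = Re Q_ζ(g) + 2 Σ_{n∈S} (w_ζ(n) − w'(n))·A_g(log n)`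
  (teeth `|x_j| ≤ A`, window `A + b`);
* `autocorrRe_combRe_of_strayFree` — if every difference `x_j − x_l ≠ log n` stays `2b` away from
  `log n` (STRAY-FREE at `n`), then `A_g(log n) = ν(n)·‖g₁‖₂²` with the signed lag count
  `ν(n) = Σ_{x_j − x_l = log n} ε_j ε_l` (`lagCount`);
* `comb_negative_or_zeta_not_positive` — **THEOREM F5-COMB**: for a comb stray-free on `S` with
  `|ε_j| ≤ 1`, if `Re Q_ζ(g₁) ≤ ε‖g₁‖₂²` and `(2^{m+1} − 2)·ε < 2 Σ_{n∈S} c_n ν(n)` then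
  `Re Q_{w'}(g) < 0` or `ζ` is not Weil-positive on `[-(A+b), A+b]` (PSD half from
  `PfPersistenceF5CombPSD.re_weilQuadratic_comb_le`).  Choosing one designated pair of teeth per site
  with `ε_j ε_l = sgn c_n` makes `Σ c_n ν(n) = Σ|c_n|`: the detection depth of a signed / balanced /
  moment-matched re-weighting is its `ℓ¹` mass — prime-sum cancellations (`Σ c_n = Σ c_n log n = … = 0`)
  buy nothing, and the pair margin `D` of F5-PAIR is a floor, not the depth (GAP F5-SWAP-G(β) is moot;
  the residual is the onset hairline only, FAKES §5.8 add. 2).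

All statements are RH-free and weight-free (`w'` arbitrary off `w_ζ` on `S`).  References: A. Weil 1952;
E. Bombieri, Rend. Mat. Acc. Lincei (9) 11 (2000) §3–4.
-/

set_option linter.dupNamespace false  -- the mandated namespace repeats `RiemannHypothesis`

noncomputable section

open scoped ArithmeticFunction ComplexConjugate
open Set MeasureTheory Complex Literature.NumberTheory.LFunctions
open Summit.RiemannHypothesis.RiemannHypothesis.Theorems.PfPersistenceDownCone
open Summit.RiemannHypothesis.RiemannHypothesis.Theorems.PfPersistenceConeTailBound
  (le_log_floor_succ_half)
open Summit.RiemannHypothesis.RiemannHypothesis.Theorems.PfPersistenceBarrier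
open Summit.RiemannHypothesis.RiemannHypothesis.Theorems.PfPersistenceBarrier.ExplicitDatum
open Summit.RiemannHypothesis.RiemannHypothesis.Theorems.PfPersistenceF5SignedTwins (autocorrRe
  weilConv_weilReflect_eq_autocorrRe autocorrRe_eq_integral autocorrRe_neg autocorrRe_zero
  autocorrRe_eq_zero_of_le)
open Summit.RiemannHypothesis.RiemannHypothesis.Theorems.PfPersistenceF5PairMargin
  (integrable_mul_shift)
open Summit.RiemannHypothesis.RiemannHypothesis.Theorems.PfPersistenceF5CombPSD (comb
  isWeilTest_comb tsupport_comb_subset re_weilQuadratic_comb_le)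

namespace Summit.RiemannHypothesis.RiemannHypothesis.Theorems.PfPersistenceF5Comb

variable {g₁ : ℝ → ℝ} {b : ℝ} {m : ℕ}

/-! ## §1 Real combs and their lag profile -/

/-- The real signed comb `Σ_{j<m} ε_j g₁(· − x_j)`. -/
def combRe (m : ℕ) (x ε : Fin m → ℝ) (g₁ : ℝ → ℝ) : ℝ → ℝ :=
  fun t ↦ ∑ j, ε j * g₁ (t - x j)

/-- The comb of a real test is (the complexification of) the real comb. -/
theorem comb_ofReal (m : ℕ) (x ε : Fin m → ℝ) (g₁ : ℝ → ℝ) :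
    comb m x ε (fun t ↦ (g₁ t : ℂ)) = fun t ↦ ((combRe m x ε g₁ t : ℝ) : ℂ) := by
  funext t
  simp only [comb, combRe]
  push_cast
  rfl

/-- **Lag profile of a comb.** `A_g(y) = Σ_{j,l} ε_j ε_l A_{g₁}(y − (x_j − x_l))` (expand the product
and translate each integral). [folklore] -/
theorem autocorrRe_combRe (hg : IsWeilTest fun t ↦ (g₁ t : ℂ)) (x ε : Fin m → ℝ) (y : ℝ) :
    autocorrRe (combRe m x ε g₁) y = ∑ j, ∑ l, ε j * ε l * autocorrRe g₁ (y - (x j - x l)) := by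
  have hint : ∀ j l, Integrable fun u ↦ g₁ (u - x j) * g₁ (u - y - x l) := by
    intro j l
    have h := (integrable_mul_shift hg (y - (x j - x l))).comp_sub_right (x j)
    refine h.congr (Filter.Eventually.of_forall fun u ↦ ?_)
    show g₁ (u - x j) * g₁ (u - x j - (y - (x j - x l))) = g₁ (u - x j) * g₁ (u - y - x l)
    ring_nf
  have hterm : ∀ j l, ∫ u, ε j * ε l * (g₁ (u - x j) * g₁ (u - y - x l)) =
      ε j * ε l * autocorrRe g₁ (y - (x j - x l)) := by
    intro j l
    rw [integral_const_mul, autocorrRe_eq_integral,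
      ← integral_sub_right_eq_self (fun u ↦ g₁ u * g₁ (u - (y - (x j - x l)))) (x j)]
    congr 1
    refine integral_congr_ae (Filter.Eventually.of_forall fun u ↦ ?_)
    show g₁ (u - x j) * g₁ (u - y - x l) = g₁ (u - x j) * g₁ (u - x j - (y - (x j - x l)))
    ring_nf
  rw [autocorrRe_eq_integral]
  have hexp : (fun u ↦ combRe m x ε g₁ u * combRe m x ε g₁ (u - y)) =
      fun u ↦ ∑ j, ∑ l, ε j * ε l * (g₁ (u - x j) * g₁ (u - y - x l)) := by
    funext u
    simp only [combRe, Finset.sum_mul_sum]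
    refine Finset.sum_congr rfl fun j _ ↦ Finset.sum_congr rfl fun l _ ↦ ?_
    ring
  rw [hexp, integral_finsetSum _ fun j _ ↦
    integrable_finsetSum _ fun l _ ↦ (hint j l).const_mul (ε j * ε l)]
  refine Finset.sum_congr rfl fun j _ ↦ ?_
  rw [integral_finsetSum _ fun l _ ↦ (hint j l).const_mul (ε j * ε l)]
  exact Finset.sum_congr rfl fun l _ ↦ hterm j l

/-- The lag profile of a comb vanishes at lags beyond `2A + 2b` (`|x_j| ≤ A`, `g₁ ⊆ [-b, b]`). [folklore] -/
theorem autocorrRe_combRe_eq_zero (hg : IsWeilTest fun t ↦ (g₁ t : ℂ))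
    (hs : tsupport (fun t ↦ (g₁ t : ℂ)) ⊆ Icc (-b) b) (hb : 0 ≤ b) {A : ℝ} {x : Fin m → ℝ}
    (hx : ∀ j, |x j| ≤ A) (ε : Fin m → ℝ) {y : ℝ} (hy : 2 * A + 2 * b ≤ y) :
    autocorrRe (combRe m x ε g₁) y = 0 := by
  rw [autocorrRe_combRe hg]
  refine Finset.sum_eq_zero fun j _ ↦ Finset.sum_eq_zero fun l _ ↦ ?_
  obtain ⟨hj1, hj2⟩ := abs_le.1 (hx j)
  obtain ⟨hl1, hl2⟩ := abs_le.1 (hx l)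
  have h2 : 2 * b ≤ |y - (x j - x l)| := by
    rw [abs_of_nonneg (by linarith)]
    linarith
  rw [autocorrRe_eq_zero_of_le hg hs h2, mul_zero]

/-! ## §2 The exact identity for `Re Q_{w'}` of a comb -/

/-- **EXACT IDENTITY.** `w' = w_ζ` off the finite set `S`, teeth `|x_j| ≤ A`, `g₁ ⊆ [-b, b]` real:
`Re Q_{w'}(g) = Re Q_ζ(g) + 2 Σ_{n ∈ S} (w_ζ(n) − w'(n))·A_g(log n)` for the comb `g`
(`tableDatum_quadratic_eq_add_sum` on the finite-prime window above `A + b`; `A_g` is even and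
vanishes beyond `2A + 2b`). [cite: Bombieri2000Weil, §4] -/
theorem comb_re_eq {w' : ℕ → ℝ} {S : Finset ℕ} (hb : 0 < b)
    (hoff : ∀ n ∉ S, w' n = zetaTable n) (hg : IsWeilTest fun t ↦ (g₁ t : ℂ))
    (hs : tsupport (fun t ↦ (g₁ t : ℂ)) ⊆ Icc (-b) b) {A : ℝ} (x ε : Fin m → ℝ)
    (hx : ∀ j, |x j| ≤ A) :
    ((tableDatum w').quadratic (comb m x ε fun t ↦ (g₁ t : ℂ))).re =
      (weilQuadratic (comb m x ε fun t ↦ (g₁ t : ℂ))).re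
        + 2 * ∑ n ∈ S, (zetaTable n - w' n) * autocorrRe (combRe m x ε g₁) (Real.log n) := by
  set g : ℝ → ℂ := comb m x ε fun t ↦ (g₁ t : ℂ) with hg_def
  have hgW : IsWeilTest g := isWeilTest_comb hg m x ε
  have hgs : tsupport g ⊆ Icc (-(A + b)) (A + b) :=
    tsupport_comb_subset hs m x ε fun j ↦ by linarith [hx j]
  have hwin := le_log_floor_succ_half (A + b)
  obtain ⟨N, hN⟩ : ∃ N : ℕ, N = ⌊Real.exp (2 * (A + b))⌋₊ := ⟨_, rfl⟩
  rw [← hN] at hwin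
  have hgs' : tsupport g ⊆ Icc (-(Real.log ((N : ℝ) + 1) / 2)) (Real.log ((N : ℝ) + 1) / 2) :=
    hgs.trans (Icc_subset_Icc (by linarith) hwin)
  -- the autocorrelation of the comb is the real profile of the real comb
  have hk : ∀ y, weilConv g (weilReflect g) y = ((autocorrRe (combRe m x ε g₁) y : ℝ) : ℂ) := by
    intro y
    rw [hg_def, comb_ofReal, weilConv_weilReflect_eq_autocorrRe]
  rw [tableDatum_quadratic_eq_add_sum zetaTable w' hgW N hgs', tableDatum_zetaTable_quadratic,
    Complex.add_re, Complex.re_sum]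
  congr 1
  have hterm : ∀ n ∈ Finset.range (N + 1),
      (((zetaTable n - w' n : ℝ) : ℂ) * (weilConv g (weilReflect g) (Real.log n) +
        weilConv g (weilReflect g) (-Real.log n))).re =
        2 * ((zetaTable n - w' n) * autocorrRe (combRe m x ε g₁) (Real.log n)) := by
    intro n _
    rw [hk, hk, autocorrRe_neg]
    push_cast
    simp only [← Complex.ofReal_sub, ← Complex.ofReal_add, ← Complex.ofReal_mul, Complex.ofReal_re]
    ring
  rw [Finset.sum_congr rfl hterm, ← Finset.mul_sum]
  congr 1
  -- both sums are the sum over `range ∩ S`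
  have h1 : ∑ n ∈ Finset.range (N + 1) ∩ S,
      (zetaTable n - w' n) * autocorrRe (combRe m x ε g₁) (Real.log n) =
      ∑ n ∈ Finset.range (N + 1), (zetaTable n - w' n) * autocorrRe (combRe m x ε g₁) (Real.log n) :=
    Finset.sum_subset Finset.inter_subset_left fun n hnr hn ↦ by
      have hnS : n ∉ S := fun h' ↦ hn (Finset.mem_inter.2 ⟨hnr, h'⟩)
      rw [hoff n hnS, sub_self, zero_mul]
  have h2 : ∑ n ∈ Finset.range (N + 1) ∩ S,
      (zetaTable n - w' n) * autocorrRe (combRe m x ε g₁) (Real.log n) =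
      ∑ n ∈ S, (zetaTable n - w' n) * autocorrRe (combRe m x ε g₁) (Real.log n) :=
    Finset.sum_subset Finset.inter_subset_right fun n hnS hn ↦ by
      have hnr : n ∉ Finset.range (N + 1) := fun h' ↦ hn (Finset.mem_inter.2 ⟨h', hnS⟩)
      rw [Finset.mem_range, not_lt] at hnr
      have hn' : (N : ℝ) + 1 ≤ n := by exact_mod_cast hnr
      have hlog : Real.log ((N : ℝ) + 1) ≤ Real.log n := Real.log_le_log (by positivity) hn'
      have hy : 2 * A + 2 * b ≤ Real.log n := by linarith
      rw [autocorrRe_combRe_eq_zero hg hs hb.le hx ε hy, mul_zero]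
  rw [← h1, h2]

/-! ## §3 Stray-free combs: the lag profile at a site is the signed lag count -/

/-- The signed LAG COUNT of the comb at lag `L`: `ν(L) = Σ_{j,l : x_j − x_l = L} ε_j ε_l`. -/
def lagCount (m : ℕ) (x ε : Fin m → ℝ) (L : ℝ) : ℝ :=
  ∑ j, ∑ l, if x j - x l = L then ε j * ε l else 0

/-! A comb with teeth `x` is STRAY-FREE at lag `L` (for profile half-width `b`) when every difference
`x_j − x_l` other than `L` itself stays `2b` away from `L`:
`∀ j l, x j - x l ≠ L → 2 * b ≤ |L - (x j - x l)|` (kept as an explicit hypothesis below). -/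

/-- **Stray-free evaluation.** `A_g(L) = ν(L)·‖g₁‖₂²` for a comb stray-free at `L` (designated
differences give `A_{g₁}(0) = ‖g₁‖₂²`, all others vanish by support). [folklore] -/
theorem autocorrRe_combRe_of_strayFree (hg : IsWeilTest fun t ↦ (g₁ t : ℂ))
    (hs : tsupport (fun t ↦ (g₁ t : ℂ)) ⊆ Icc (-b) b) (x ε : Fin m → ℝ) {L : ℝ}
    (hfree : ∀ j l, x j - x l ≠ L → 2 * b ≤ |L - (x j - x l)|) :
    autocorrRe (combRe m x ε g₁) L = lagCount m x ε L * ∫ t, ‖(g₁ t : ℂ)‖ ^ 2 := by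
  rw [autocorrRe_combRe hg, lagCount, Finset.sum_mul]
  refine Finset.sum_congr rfl fun j _ ↦ ?_
  rw [Finset.sum_mul]
  refine Finset.sum_congr rfl fun l _ ↦ ?_
  by_cases h : x j - x l = L
  · rw [if_pos h, h, sub_self, autocorrRe_zero]
  · rw [if_neg h, autocorrRe_eq_zero_of_le hg hs (hfree j l h), mul_zero, zero_mul]

/-- **EXACT IDENTITY, stray-free form.** For a comb stray-free at every site of `S`:
`Re Q_{w'}(g) = Re Q_ζ(g) − 2‖g₁‖₂² Σ_{n∈S} c_n ν(log n)`, `c_n = w'(n) − w_ζ(n)`. [folklore] -/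
theorem comb_re_eq_of_strayFree {w' : ℕ → ℝ} {S : Finset ℕ} (hb : 0 < b)
    (hoff : ∀ n ∉ S, w' n = zetaTable n) (hg : IsWeilTest fun t ↦ (g₁ t : ℂ))
    (hs : tsupport (fun t ↦ (g₁ t : ℂ)) ⊆ Icc (-b) b) {A : ℝ} (x ε : Fin m → ℝ)
    (hx : ∀ j, |x j| ≤ A) (hfree : ∀ n ∈ S, ∀ j l, x j - x l ≠ Real.log n → 2 * b ≤ |Real.log n - (x j - x l)|) :
    ((tableDatum w').quadratic (comb m x ε fun t ↦ (g₁ t : ℂ))).re =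
      (weilQuadratic (comb m x ε fun t ↦ (g₁ t : ℂ))).re
        - 2 * (∫ t, ‖(g₁ t : ℂ)‖ ^ 2) *
          ∑ n ∈ S, (w' n - zetaTable n) * lagCount m x ε (Real.log n) := by
  rw [comb_re_eq hb hoff hg hs x ε hx]
  have hterm : ∀ n ∈ S, (zetaTable n - w' n) * autocorrRe (combRe m x ε g₁) (Real.log n) =
      -((∫ t, ‖(g₁ t : ℂ)‖ ^ 2) * ((w' n - zetaTable n) * lagCount m x ε (Real.log n))) := by
    intro n hn
    rw [autocorrRe_combRe_of_strayFree hg hs x ε (hfree n hn)]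
    ring
  rw [Finset.sum_congr rfl hterm, Finset.sum_neg_distrib, ← Finset.mul_sum]
  ring

/-! ## §4 THEOREM F5-COMB -/

/-- **BOUND under window positivity.** Stray-free comb, `|ε_j| ≤ 1`, `|x_j| ≤ A`, `0 ≤ A`,
`Re Q_ζ(g₁) ≤ ε‖g₁‖₂²`, `ζ` Weil-positive on `[-(A+b), A+b]`
`⟹ Re Q_{w'}(g) ≤ (2^{m+1} − 2)ε‖g₁‖₂² − 2‖g₁‖₂² Σ_{n∈S} c_n ν(log n)`. [cite: Bombieri2000Weil, §4] -/
theorem comb_re_le {w' : ℕ → ℝ} {S : Finset ℕ} (hb : 0 < b)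
    (hoff : ∀ n ∉ S, w' n = zetaTable n) (hg : IsWeilTest fun t ↦ (g₁ t : ℂ))
    (hs : tsupport (fun t ↦ (g₁ t : ℂ)) ⊆ Icc (-b) b) {A : ℝ} (hA : 0 ≤ A) (x ε : Fin m → ℝ)
    (hx : ∀ j, |x j| ≤ A) (hε : ∀ j, (ε j) ^ 2 ≤ 1)
    (hfree : ∀ n ∈ S, ∀ j l, x j - x l ≠ Real.log n → 2 * b ≤ |Real.log n - (x j - x l)|) {ε₀ : ℝ}
    (hq : (weilQuadratic fun t ↦ (g₁ t : ℂ)).re ≤ ε₀ * ∫ t, ‖(g₁ t : ℂ)‖ ^ 2)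
    (hW : WeilPositivityOn (A + b)) :
    ((tableDatum w').quadratic (comb m x ε fun t ↦ (g₁ t : ℂ))).re ≤
      (2 ^ (m + 1) - 2) * (ε₀ * ∫ t, ‖(g₁ t : ℂ)‖ ^ 2)
        - 2 * (∫ t, ‖(g₁ t : ℂ)‖ ^ 2) *
          ∑ n ∈ S, (w' n - zetaTable n) * lagCount m x ε (Real.log n) := by
  rw [comb_re_eq_of_strayFree hb hoff hg hs x ε hx hfree]
  have hx' : ∀ j, |x j| ≤ (A + b) - b := fun j ↦ by linarith [hx j]
  have h := re_weilQuadratic_comb_le hg hs (by linarith : b ≤ A + b) hW hq m x ε hx' hε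
  linarith

/-- **THEOREM F5-COMB (signed re-weightings are caught at ℓ¹ depth).** `w' = w_ζ` off the finite
set `S`, `c_n = w'(n) − w_ζ(n)`; `g₁` a real Weil test in `[-b, b]`, `b > 0`; a comb of `m` signed
translates (`|ε_j| ≤ 1`, teeth `|x_j| ≤ A`, `0 ≤ A`) stray-free at every site of `S`, with signed lag
counts `ν(log n)`.  If `Re Q_ζ(g₁) ≤ ε‖g₁‖₂²` and
`(2^{m+1} − 2)·ε‖g₁‖₂² < 2‖g₁‖₂²·Σ_{n∈S} c_n ν(log n)`, then EITHER `ζ`'s explicit-formula functional is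
not Weil-positive on `[-(A+b), A+b]` OR `Re Q_{w'}(comb) < 0` — the fake is negative on the window.
With one designated pair of teeth per site (`ε_j ε_l = sgn c_n`) the right side is `2‖g₁‖₂²·Σ|c_n|`:
the depth is the `ℓ¹` mass, cancellations in `Σ c_n`, `Σ c_n log n`, … notwithstanding.
[cite: Bombieri2000Weil, §4] -/
theorem comb_negative_or_zeta_not_positive {w' : ℕ → ℝ} {S : Finset ℕ} (hb : 0 < b)
    (hoff : ∀ n ∉ S, w' n = zetaTable n) (hg : IsWeilTest fun t ↦ (g₁ t : ℂ))
    (hs : tsupport (fun t ↦ (g₁ t : ℂ)) ⊆ Icc (-b) b) {A : ℝ} (hA : 0 ≤ A) (x ε : Fin m → ℝ)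
    (hx : ∀ j, |x j| ≤ A) (hε : ∀ j, (ε j) ^ 2 ≤ 1)
    (hfree : ∀ n ∈ S, ∀ j l, x j - x l ≠ Real.log n → 2 * b ≤ |Real.log n - (x j - x l)|) {ε₀ : ℝ}
    (hq : (weilQuadratic fun t ↦ (g₁ t : ℂ)).re ≤ ε₀ * ∫ t, ‖(g₁ t : ℂ)‖ ^ 2)
    (hbig : (2 ^ (m + 1) - 2) * (ε₀ * ∫ t, ‖(g₁ t : ℂ)‖ ^ 2) <
      2 * (∫ t, ‖(g₁ t : ℂ)‖ ^ 2) * ∑ n ∈ S, (w' n - zetaTable n) * lagCount m x ε (Real.log n)) :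
    ¬ WeilPositivityOn (A + b) ∨
      ((tableDatum w').quadratic (comb m x ε fun t ↦ (g₁ t : ℂ))).re < 0 := by
  by_cases hW : WeilPositivityOn (A + b)
  · right
    have h := comb_re_le hb hoff hg hs hA x ε hx hε hfree hq hW
    linarith
  · exact Or.inl hW

/-- **F5-COMB, normalised form.** With `‖g₁‖₂² > 0` the threshold reads
`(2^{m} − 1)·ε < Σ_{n∈S} c_n ν(log n)`. [cite: Bombieri2000Weil, §4] -/
theorem comb_negative_or_zeta_not_positive' {w' : ℕ → ℝ} {S : Finset ℕ} (hb : 0 < b)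
    (hoff : ∀ n ∉ S, w' n = zetaTable n) (hg : IsWeilTest fun t ↦ (g₁ t : ℂ))
    (hs : tsupport (fun t ↦ (g₁ t : ℂ)) ⊆ Icc (-b) b) {A : ℝ} (hA : 0 ≤ A) (x ε : Fin m → ℝ)
    (hx : ∀ j, |x j| ≤ A) (hε : ∀ j, (ε j) ^ 2 ≤ 1)
    (hfree : ∀ n ∈ S, ∀ j l, x j - x l ≠ Real.log n → 2 * b ≤ |Real.log n - (x j - x l)|) {ε₀ : ℝ}
    (hq : (weilQuadratic fun t ↦ (g₁ t : ℂ)).re ≤ ε₀ * ∫ t, ‖(g₁ t : ℂ)‖ ^ 2)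
    (hpos : 0 < ∫ t, ‖(g₁ t : ℂ)‖ ^ 2)
    (hbig : (2 ^ m - 1) * ε₀ < ∑ n ∈ S, (w' n - zetaTable n) * lagCount m x ε (Real.log n)) :
    ¬ WeilPositivityOn (A + b) ∨
      ((tableDatum w').quadratic (comb m x ε fun t ↦ (g₁ t : ℂ))).re < 0 := by
  refine comb_negative_or_zeta_not_positive hb hoff hg hs hA x ε hx hε hfree hq ?_
  have h2 : (2 : ℝ) ^ (m + 1) - 2 = 2 * (2 ^ m - 1) := by ring
  rw [h2]
  have := mul_lt_mul_of_pos_left hbig hpos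
  nlinarith [this, hpos]

end Summit.RiemannHypothesis.RiemannHypothesis.Theorems.PfPersistenceF5Comb

end
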